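import Summits.Ventures.CertifiedManyBodySolver.Downfold.EmeryScaleNodeAtoms
import Summits.Ventures.CertifiedManyBodySolver.Downfold.EmeryContourNesting
import Literature.Analysis.ValidatedNumerics.FixedPointInterval
import HarnessLib

/-!
# FIXED-POINT INTERVAL IMAGES OF THE SCALE-NODE ATOMS AND THE KERNEL-DECIDABLE NESTING LEAF TEST WITH ITS SOUNDNESS — the arithmetic core of the box
# checker for the scale coordinate, part I (INFL-3to1-B §B.88 (k)–(l))

Venture CertifiedManyBodySolver, cell `pub/hubbard-downfold` (stage S1; INFLATION-RULES-3to1-B §B.88), seat hubbard-downfold-mod-4 (technique B = band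
level, g36); namespace `Summit.Ventures.CertifiedManyBodySolver.Downfold.Emery`. Everything PROVED (0 sorry). WHAT THIS IS NOT: a statement about any
material; no number lives here; `U = 0` one-body kinematics of the σ model.

All quantities are enclosed in the tree's fixed-point intervals `FI` (integers at scale `2^48`, `Literature.Analysis.ValidatedNumerics.FixedPointInterval`,
inclusion property of every operation). §1: images `fiX` of the atoms `snX` and of the difference quotients `dsnX` of `EmeryScaleNodeAtoms`, each with its
inclusion theorem `mem_fiX` (definition and proof term generated from one expression tree, then identified with the tree's closed form by `ring`).
§2: `quadTest` (a quadratic with interval coefficients is `≥ 0` on `[0, 1]`: the four elementary side conditions of `quad_nonneg_on_unitInterval`).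
§3: **`nestLeaf`** — on boxes of rows `θ`, energies `e`, steps `s` and a move `(d, σ)`: the Fermi sea of `θ` at `e` lies inside the Fermi sea of
`θ + s·d` at `e + s·σ` (soundness `charCubic_transfer_of_nestLeaf`, via the ratio form `nestQuad_nonneg_of_ratio` and `charCubic_nonneg_transfer`; the
`x`-range is cut at `x ≤ cA/(4fsD)`, which every occupied point satisfies). The path leaf and the bisection driver follow in `EmeryScaleLeverFIPath` /
`EmeryScaleLeverCheck`.

Sources: three-band model [HybertsenSchluterChristensen1989, Eq. (1)]; energy-linearised one-band image [AndersenEtAl1995, §6]; interval arithmetic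
[folklore] (Moore 1966).
-/

noncomputable section

namespace Summit.Ventures.CertifiedManyBodySolver.Downfold.Emery

open Real Set Literature.Analysis.ValidatedNumerics.Numerics

/-! ## §0 Plumbing -/

/-- Transport of membership along an equality of reals. [folklore] -/
theorem mem_of_eq {x y : ℝ} {I : FI} (h : FI.mem x I) (e : x = y) : FI.mem y I := e ▸ h

/-- `0 ≤ I.lo ⇒ 0 ≤ x` for `x ∈ I`. [folklore] -/
theorem nonneg_of_lo_nonneg {x : ℝ} {I : FI} (hx : FI.mem x I) (h : 0 ≤ I.lo) : 0 ≤ x := by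
  have h1 := FI.lo_div_le hx
  have h0 : (0 : ℝ) ≤ (I.lo : ℝ) / SC := div_nonneg (by exact_mod_cast h) SC_pos.le
  linarith

/-- `I.hi ≤ 0 ⇒ x ≤ 0` for `x ∈ I`. [folklore] -/
theorem nonpos_of_hi_nonpos {x : ℝ} {I : FI} (hx : FI.mem x I) (h : I.hi ≤ 0) : x ≤ 0 := by
  have h1 := FI.le_hi_div hx
  have h0 : (I.hi : ℝ) / SC ≤ 0 := div_nonpos_of_nonpos_of_nonneg (by exact_mod_cast h) SC_pos.le
  linarith

/-- `x ∈ I`, `I.hi ≤ k` ⇒ `x ≤ k/SC`. [folklore] -/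
theorem le_scaled_of_hi_le {x : ℝ} {I : FI} {k : ℤ} (hx : FI.mem x I) (h : I.hi ≤ k) : x ≤ (k : ℝ) / SC := by
  have h1 := FI.le_hi_div hx
  have : (I.hi : ℝ) / SC ≤ (k : ℝ) / SC := div_le_div_of_nonneg_right (by exact_mod_cast h) SC_pos.le
  linarith

/-- `k ≤ I.lo`, `x ∈ I` ⇒ `k/SC ≤ x`. [folklore] -/
theorem scaled_le_of_le_lo {x : ℝ} {I : FI} {k : ℤ} (hx : FI.mem x I) (h : k ≤ I.lo) : (k : ℝ) / SC ≤ x := by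
  have h1 := FI.lo_div_le hx
  have : (k : ℝ) / SC ≤ (I.lo : ℝ) / SC := div_le_div_of_nonneg_right (by exact_mod_cast h) SC_pos.le
  linarith

/-! ## §1 Images of the atoms and of the difference quotients -/

/-- FI image of `snE`. [folklore] -/
def fiE (ID IE : FI) : FI := ((ID).add IE)

/-- Inclusion: `snE ∈ fiE`. [folklore] -/
theorem mem_fiE {Δ e : ℝ} {ID IE : FI} (hD : FI.mem Δ ID) (hE : FI.mem e IE) :
    FI.mem (snE Δ e) (fiE ID IE) := by
  have h : FI.mem (Δ + e) (fiE ID IE) := (FI.mem_add hD hE)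
  refine mem_of_eq h ?_
  unfold snE; ring

/-- FI image of `snR`. [folklore] -/
def fiR (IA IC IE : FI) : FI := ((((IA).sqr)).sub ((IC).mul IE))

/-- Inclusion: `snR ∈ fiR`. [folklore] -/
theorem mem_fiR {a c e : ℝ} {IA IC IE : FI} (hA : FI.mem a IA) (hC : FI.mem c IC) (hE : FI.mem e IE) :
    FI.mem (snR a c e) (fiR IA IC IE) := by
  have h : FI.mem ((a ^ 2) - (c * e)) (fiR IA IC IE) := (FI.mem_sub (FI.mem_sqr hA) (FI.mem_mul hC hE))
  refine mem_of_eq h ?_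
  unfold snR; ring

/-- FI image of `snG`. [folklore] -/
def fiG (IA IB IE : FI) : FI := ((((IA).sqr)).add ((IB).mul IE))

/-- Inclusion: `snG ∈ fiG`. [folklore] -/
theorem mem_fiG {a b e : ℝ} {IA IB IE : FI} (hA : FI.mem a IA) (hB : FI.mem b IB) (hE : FI.mem e IE) :
    FI.mem (snG a b e) (fiG IA IB IE) := by
  have h : FI.mem ((a ^ 2) + (b * e)) (fiG IA IB IE) := (FI.mem_add (FI.mem_sqr hA) (FI.mem_mul hB hE))
  refine mem_of_eq h ?_
  unfold snG; ring

/-- FI image of `snP`. [folklore] -/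
def fiP (IA IB IC IE : FI) : FI := ((((((IA).sqr)).mulInt 2)).add ((((IB).sub IC)).mul IE))

/-- Inclusion: `snP ∈ fiP`. [folklore] -/
theorem mem_fiP {a b c e : ℝ} {IA IB IC IE : FI} (hA : FI.mem a IA) (hB : FI.mem b IB) (hC : FI.mem c IC) (hE : FI.mem e IE) :
    FI.mem (snP a b c e) (fiP IA IB IC IE) := by
  have h : FI.mem (((a ^ 2) * ((2 : ℤ) : ℝ)) + ((b - c) * e)) (fiP IA IB IC IE) := (FI.mem_add (FI.mem_mulInt (FI.mem_sqr hA) 2) (FI.mem_mul (FI.mem_sub hB hC) hE))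
  refine mem_of_eq h ?_
  unfold snP; push_cast; ring

/-- FI image of `snQ`. [folklore] -/
def fiQ (ID IA IB IC IE : FI) : FI := ((((((((IA).sqr)).mulInt 2)).mul ((ID).add IE))).add ((IE).mul (fiP IA IB IC IE)))

/-- Inclusion: `snQ ∈ fiQ`. [folklore] -/
theorem mem_fiQ {Δ a b c e : ℝ} {ID IA IB IC IE : FI} (hD : FI.mem Δ ID) (hA : FI.mem a IA) (hB : FI.mem b IB) (hC : FI.mem c IC) (hE : FI.mem e IE) :
    FI.mem (snQ Δ a b c e) (fiQ ID IA IB IC IE) := by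
  have h : FI.mem ((((a ^ 2) * ((2 : ℤ) : ℝ)) * (Δ + e)) + (e * (snP a b c e))) (fiQ ID IA IB IC IE) := (FI.mem_add (FI.mem_mul (FI.mem_mulInt (FI.mem_sqr hA) 2) (FI.mem_add hD hE)) (FI.mem_mul hE (mem_fiP hA hB hC hE)))
  refine mem_of_eq h ?_
  unfold snQ; push_cast; ring

/-- FI image of `snF`. [folklore] -/
def fiF (ID IA IB IC IE : FI) : FI := ((((((ID).add IE)).mul (fiR IA IC IE))).add ((((((IB).add IC)).mulInt 2)).mul (fiP IA IB IC IE)))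

/-- Inclusion: `snF ∈ fiF`. [folklore] -/
theorem mem_fiF {Δ a b c e : ℝ} {ID IA IB IC IE : FI} (hD : FI.mem Δ ID) (hA : FI.mem a IA) (hB : FI.mem b IB) (hC : FI.mem c IC) (hE : FI.mem e IE) :
    FI.mem (snF Δ a b c e) (fiF ID IA IB IC IE) := by
  have h : FI.mem (((Δ + e) * (snR a c e)) + (((b + c) * ((2 : ℤ) : ℝ)) * (snP a b c e))) (fiF ID IA IB IC IE) := (FI.mem_add (FI.mem_mul (FI.mem_add hD hE) (mem_fiR hA hC hE)) (FI.mem_mul (FI.mem_mulInt (FI.mem_add hB hC) 2) (mem_fiP hA hB hC hE)))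
  refine mem_of_eq h ?_
  unfold snF; push_cast; ring

/-- FI image of `dsnE`. [folklore] -/
def fidE (IDD ISG : FI) : FI := ((IDD).add ISG)

/-- Inclusion: `dsnE ∈ fidE`. [folklore] -/
theorem mem_fidE {dΔ σ : ℝ} {IDD ISG : FI} (hDD : FI.mem dΔ IDD) (hSG : FI.mem σ ISG) :
    FI.mem (dsnE dΔ σ) (fidE IDD ISG) := by
  have h : FI.mem (dΔ + σ) (fidE IDD ISG) := (FI.mem_add hDD hSG)
  refine mem_of_eq h ?_
  unfold dsnE; ring

/-- FI image of `dsnR`. [folklore] -/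
def fidR (IA IC IE IDA IDC ISG IS : FI) : FI := ((((((((((IA).mul IDA)).mulInt 2)).sub ((IDC).mul IE))).sub ((IC).mul ISG))).add ((IS).mul ((((IDA).sqr)).sub ((IDC).mul ISG))))

/-- Inclusion: `dsnR ∈ fidR`. [folklore] -/
theorem mem_fidR {a c e da dc σ s : ℝ} {IA IC IE IDA IDC ISG IS : FI} (hA : FI.mem a IA) (hC : FI.mem c IC) (hE : FI.mem e IE) (hDA : FI.mem da IDA) (hDC : FI.mem dc IDC) (hSG : FI.mem σ ISG) (hS : FI.mem s IS) :
    FI.mem (dsnR a c e da dc σ s) (fidR IA IC IE IDA IDC ISG IS) := by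
  have h : FI.mem (((((a * da) * ((2 : ℤ) : ℝ)) - (dc * e)) - (c * σ)) + (s * ((da ^ 2) - (dc * σ)))) (fidR IA IC IE IDA IDC ISG IS) := (FI.mem_add (FI.mem_sub (FI.mem_sub (FI.mem_mulInt (FI.mem_mul hA hDA) 2) (FI.mem_mul hDC hE)) (FI.mem_mul hC hSG)) (FI.mem_mul hS (FI.mem_sub (FI.mem_sqr hDA) (FI.mem_mul hDC hSG))))
  refine mem_of_eq h ?_
  unfold dsnR; push_cast; ring

/-- FI image of `dsnG`. [folklore] -/
def fidG (IA IB IE IDA IDB ISG IS : FI) : FI := ((((((((((IA).mul IDA)).mulInt 2)).add ((IDB).mul IE))).add ((IB).mul ISG))).add ((IS).mul ((((IDA).sqr)).add ((IDB).mul ISG))))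

/-- Inclusion: `dsnG ∈ fidG`. [folklore] -/
theorem mem_fidG {a b e da db σ s : ℝ} {IA IB IE IDA IDB ISG IS : FI} (hA : FI.mem a IA) (hB : FI.mem b IB) (hE : FI.mem e IE) (hDA : FI.mem da IDA) (hDB : FI.mem db IDB) (hSG : FI.mem σ ISG) (hS : FI.mem s IS) :
    FI.mem (dsnG a b e da db σ s) (fidG IA IB IE IDA IDB ISG IS) := by
  have h : FI.mem (((((a * da) * ((2 : ℤ) : ℝ)) + (db * e)) + (b * σ)) + (s * ((da ^ 2) + (db * σ)))) (fidG IA IB IE IDA IDB ISG IS) := (FI.mem_add (FI.mem_add (FI.mem_add (FI.mem_mulInt (FI.mem_mul hA hDA) 2) (FI.mem_mul hDB hE)) (FI.mem_mul hB hSG)) (FI.mem_mul hS (FI.mem_add (FI.mem_sqr hDA) (FI.mem_mul hDB hSG))))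
  refine mem_of_eq h ?_
  unfold dsnG; push_cast; ring

/-- FI image of `dsnP`. [folklore] -/
def fidP (IA IB IC IE IDA IDB IDC ISG IS : FI) : FI := ((((((((((IA).mul IDA)).mulInt 4)).add ((((IDB).sub IDC)).mul IE))).add ((((IB).sub IC)).mul ISG))).add ((IS).mul ((((((IDA).sqr)).mulInt 2)).add ((((IDB).sub IDC)).mul ISG))))

/-- Inclusion: `dsnP ∈ fidP`. [folklore] -/
theorem mem_fidP {a b c e da db dc σ s : ℝ} {IA IB IC IE IDA IDB IDC ISG IS : FI} (hA : FI.mem a IA) (hB : FI.mem b IB) (hC : FI.mem c IC) (hE : FI.mem e IE) (hDA : FI.mem da IDA) (hDB : FI.mem db IDB) (hDC : FI.mem dc IDC) (hSG : FI.mem σ ISG) (hS : FI.mem s IS) :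
    FI.mem (dsnP a b c e da db dc σ s) (fidP IA IB IC IE IDA IDB IDC ISG IS) := by
  have h : FI.mem (((((a * da) * ((4 : ℤ) : ℝ)) + ((db - dc) * e)) + ((b - c) * σ)) + (s * (((da ^ 2) * ((2 : ℤ) : ℝ)) + ((db - dc) * σ)))) (fidP IA IB IC IE IDA IDB IDC ISG IS) := (FI.mem_add (FI.mem_add (FI.mem_add (FI.mem_mulInt (FI.mem_mul hA hDA) 4) (FI.mem_mul (FI.mem_sub hDB hDC) hE)) (FI.mem_mul (FI.mem_sub hB hC) hSG)) (FI.mem_mul hS (FI.mem_add (FI.mem_mulInt (FI.mem_sqr hDA) 2) (FI.mem_mul (FI.mem_sub hDB hDC) hSG))))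
  refine mem_of_eq h ?_
  unfold dsnP; push_cast; ring

/-- FI image of `dsnQ`. [folklore] -/
def fidQ (ID IA IB IC IE IDD IDA IDB IDC ISG IS : FI) : FI := ((((((((((((((IA).mul IDA)).mulInt 2)).add ((IS).mul ((IDA).sqr)))).mul (((fiE ID IE)).add ((IS).mul (fidE IDD ISG))))).add ((((IA).sqr)).mul (fidE IDD ISG)))).mulInt 2)).add ((((ISG).mul (((fiP IA IB IC IE)).add ((IS).mul (fidP IA IB IC IE IDA IDB IDC ISG IS))))).add ((IE).mul (fidP IA IB IC IE IDA IDB IDC ISG IS))))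

/-- Inclusion: `dsnQ ∈ fidQ`. [folklore] -/
theorem mem_fidQ {Δ a b c e dΔ da db dc σ s : ℝ} {ID IA IB IC IE IDD IDA IDB IDC ISG IS : FI} (hD : FI.mem Δ ID) (hA : FI.mem a IA) (hB : FI.mem b IB) (hC : FI.mem c IC) (hE : FI.mem e IE) (hDD : FI.mem dΔ IDD) (hDA : FI.mem da IDA) (hDB : FI.mem db IDB) (hDC : FI.mem dc IDC) (hSG : FI.mem σ ISG) (hS : FI.mem s IS) :
    FI.mem (dsnQ Δ a b c e dΔ da db dc σ s) (fidQ ID IA IB IC IE IDD IDA IDB IDC ISG IS) := by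
  have h : FI.mem (((((((a * da) * ((2 : ℤ) : ℝ)) + (s * (da ^ 2))) * ((snE Δ e) + (s * (dsnE dΔ σ)))) + ((a ^ 2) * (dsnE dΔ σ))) * ((2 : ℤ) : ℝ)) + ((σ * ((snP a b c e) + (s * (dsnP a b c e da db dc σ s)))) + (e * (dsnP a b c e da db dc σ s)))) (fidQ ID IA IB IC IE IDD IDA IDB IDC ISG IS) := (FI.mem_add (FI.mem_mulInt (FI.mem_add (FI.mem_mul (FI.mem_add (FI.mem_mulInt (FI.mem_mul hA hDA) 2) (FI.mem_mul hS (FI.mem_sqr hDA))) (FI.mem_add (mem_fiE hD hE) (FI.mem_mul hS (mem_fidE hDD hSG)))) (FI.mem_mul (FI.mem_sqr hA) (mem_fidE hDD hSG))) 2) (FI.mem_add (FI.mem_mul hSG (FI.mem_add (mem_fiP hA hB hC hE) (FI.mem_mul hS (mem_fidP hA hB hC hE hDA hDB hDC hSG hS)))) (FI.mem_mul hE (mem_fidP hA hB hC hE hDA hDB hDC hSG hS))))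
  refine mem_of_eq h ?_
  unfold dsnQ; push_cast; ring

/-- FI image of `dsnF`. [folklore] -/
def fidF (ID IA IB IC IE IDD IDA IDB IDC ISG IS : FI) : FI := (((((((((fidE IDD ISG)).mul (fiR IA IC IE))).add (((fiE ID IE)).mul (fidR IA IC IE IDA IDC ISG IS)))).add ((((IS).mul (fidE IDD ISG))).mul (fidR IA IC IE IDA IDC ISG IS)))).add ((((((((IDB).add IDC)).mul (((fiP IA IB IC IE)).add ((IS).mul (fidP IA IB IC IE IDA IDB IDC ISG IS))))).add ((((IB).add IC)).mul (fidP IA IB IC IE IDA IDB IDC ISG IS)))).mulInt 2))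

/-- Inclusion: `dsnF ∈ fidF`. [folklore] -/
theorem mem_fidF {Δ a b c e dΔ da db dc σ s : ℝ} {ID IA IB IC IE IDD IDA IDB IDC ISG IS : FI} (hD : FI.mem Δ ID) (hA : FI.mem a IA) (hB : FI.mem b IB) (hC : FI.mem c IC) (hE : FI.mem e IE) (hDD : FI.mem dΔ IDD) (hDA : FI.mem da IDA) (hDB : FI.mem db IDB) (hDC : FI.mem dc IDC) (hSG : FI.mem σ ISG) (hS : FI.mem s IS) :
    FI.mem (dsnF Δ a b c e dΔ da db dc σ s) (fidF ID IA IB IC IE IDD IDA IDB IDC ISG IS) := by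
  have h : FI.mem (((((dsnE dΔ σ) * (snR a c e)) + ((snE Δ e) * (dsnR a c e da dc σ s))) + ((s * (dsnE dΔ σ)) * (dsnR a c e da dc σ s))) + ((((db + dc) * ((snP a b c e) + (s * (dsnP a b c e da db dc σ s)))) + ((b + c) * (dsnP a b c e da db dc σ s))) * ((2 : ℤ) : ℝ))) (fidF ID IA IB IC IE IDD IDA IDB IDC ISG IS) := (FI.mem_add (FI.mem_add (FI.mem_add (FI.mem_mul (mem_fidE hDD hSG) (mem_fiR hA hC hE)) (FI.mem_mul (mem_fiE hD hE) (mem_fidR hA hC hE hDA hDC hSG hS))) (FI.mem_mul (FI.mem_mul hS (mem_fidE hDD hSG)) (mem_fidR hA hC hE hDA hDC hSG hS))) (FI.mem_mulInt (FI.mem_add (FI.mem_mul (FI.mem_add hDB hDC) (FI.mem_add (mem_fiP hA hB hC hE) (FI.mem_mul hS (mem_fidP hA hB hC hE hDA hDB hDC hSG hS)))) (FI.mem_mul (FI.mem_add hB hC) (mem_fidP hA hB hC hE hDA hDB hDC hSG hS))) 2))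
  refine mem_of_eq h ?_
  unfold dsnF; push_cast; ring

/-- FI image of `dsnA`. [folklore] -/
def fidA (ID IE IDD ISG IS : FI) : FI := ((((ISG).mul (((((fiE ID IE)).add ((IS).mul (fidE IDD ISG)))).sqr))).add ((IE).mul (((((((fiE ID IE)).mul (fidE IDD ISG))).mulInt 2)).add ((IS).mul (((fidE IDD ISG)).sqr)))))

/-- Inclusion: `dsnA ∈ fidA`. [folklore] -/
theorem mem_fidA {Δ e dΔ σ s : ℝ} {ID IE IDD ISG IS : FI} (hD : FI.mem Δ ID) (hE : FI.mem e IE) (hDD : FI.mem dΔ IDD) (hSG : FI.mem σ ISG) (hS : FI.mem s IS) :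
    FI.mem (dsnA Δ e dΔ σ s) (fidA ID IE IDD ISG IS) := by
  have h : FI.mem ((σ * (((snE Δ e) + (s * (dsnE dΔ σ))) ^ 2)) + (e * ((((snE Δ e) * (dsnE dΔ σ)) * ((2 : ℤ) : ℝ)) + (s * ((dsnE dΔ σ) ^ 2))))) (fidA ID IE IDD ISG IS) := (FI.mem_add (FI.mem_mul hSG (FI.mem_sqr (FI.mem_add (mem_fiE hD hE) (FI.mem_mul hS (mem_fidE hDD hSG))))) (FI.mem_mul hE (FI.mem_add (FI.mem_mulInt (FI.mem_mul (mem_fiE hD hE) (mem_fidE hDD hSG)) 2) (FI.mem_mul hS (FI.mem_sqr (mem_fidE hDD hSG))))))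
  refine mem_of_eq h ?_
  unfold dsnA; push_cast; ring

/-- FI image of `dsnB`. [folklore] -/
def fidB (ID IA IC IE IDD IDA IDC ISG IS : FI) : FI := (((((((((fidE IDD ISG)).mul (fiR IA IC IE))).add (((fiE ID IE)).mul (fidR IA IC IE IDA IDC ISG IS)))).add ((((IS).mul (fidE IDD ISG))).mul (fidR IA IC IE IDA IDC ISG IS)))).mulInt 4)

/-- Inclusion: `dsnB ∈ fidB`. [folklore] -/
theorem mem_fidB {Δ a c e dΔ da dc σ s : ℝ} {ID IA IC IE IDD IDA IDC ISG IS : FI} (hD : FI.mem Δ ID) (hA : FI.mem a IA) (hC : FI.mem c IC) (hE : FI.mem e IE) (hDD : FI.mem dΔ IDD) (hDA : FI.mem da IDA) (hDC : FI.mem dc IDC) (hSG : FI.mem σ ISG) (hS : FI.mem s IS) :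
    FI.mem (dsnB Δ a c e dΔ da dc σ s) (fidB ID IA IC IE IDD IDA IDC ISG IS) := by
  have h : FI.mem (((((dsnE dΔ σ) * (snR a c e)) + ((snE Δ e) * (dsnR a c e da dc σ s))) + ((s * (dsnE dΔ σ)) * (dsnR a c e da dc σ s))) * ((4 : ℤ) : ℝ)) (fidB ID IA IC IE IDD IDA IDC ISG IS) := (FI.mem_mulInt (FI.mem_add (FI.mem_add (FI.mem_mul (mem_fidE hDD hSG) (mem_fiR hA hC hE)) (FI.mem_mul (mem_fiE hD hE) (mem_fidR hA hC hE hDA hDC hSG hS))) (FI.mem_mul (FI.mem_mul hS (mem_fidE hDD hSG)) (mem_fidR hA hC hE hDA hDC hSG hS))) 4)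
  refine mem_of_eq h ?_
  unfold dsnB; push_cast; ring

/-- FI image of `dsnC`. [folklore] -/
def fidC (IA IB IC IE IDA IDB IDC ISG IS : FI) : FI := ((((((((IDB).add IDC)).mul (((fiP IA IB IC IE)).add ((IS).mul (fidP IA IB IC IE IDA IDB IDC ISG IS))))).add ((((IB).add IC)).mul (fidP IA IB IC IE IDA IDB IDC ISG IS)))).mulInt 16)

/-- Inclusion: `dsnC ∈ fidC`. [folklore] -/
theorem mem_fidC {a b c e da db dc σ s : ℝ} {IA IB IC IE IDA IDB IDC ISG IS : FI} (hA : FI.mem a IA) (hB : FI.mem b IB) (hC : FI.mem c IC) (hE : FI.mem e IE) (hDA : FI.mem da IDA) (hDB : FI.mem db IDB) (hDC : FI.mem dc IDC) (hSG : FI.mem σ ISG) (hS : FI.mem s IS) :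
    FI.mem (dsnC a b c e da db dc σ s) (fidC IA IB IC IE IDA IDB IDC ISG IS) := by
  have h : FI.mem ((((db + dc) * ((snP a b c e) + (s * (dsnP a b c e da db dc σ s)))) + ((b + c) * (dsnP a b c e da db dc σ s))) * ((16 : ℤ) : ℝ)) (fidC IA IB IC IE IDA IDB IDC ISG IS) := (FI.mem_mulInt (FI.mem_add (FI.mem_mul (FI.mem_add hDB hDC) (FI.mem_add (mem_fiP hA hB hC hE) (FI.mem_mul hS (mem_fidP hA hB hC hE hDA hDB hDC hSG hS)))) (FI.mem_mul (FI.mem_add hB hC) (mem_fidP hA hB hC hE hDA hDB hDC hSG hS))) 16)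
  refine mem_of_eq h ?_
  unfold dsnC; push_cast; ring

/-! ## §2 A quadratic with interval coefficients is non-negative on `[0, 1]` -/

/-- `quadTest α β γ`: `α.lo ≥ 0 ∧ (α + β + γ).lo ≥ 0 ∧ [(2α + β).lo ≥ 0 ∨ β.lo ≥ 0 ∨ (β + 2γ).hi ≤ 0 ∨ (γ.lo ≥ 0 ∧ (4αγ − β²).lo ≥ 0)]`. [folklore] -/
def quadTest (Ia Ib Ig : FI) : Bool :=
  decide (0 ≤ Ia.lo) && decide (0 ≤ ((Ia.add Ib).add Ig).lo) &&
    (decide (0 ≤ ((Ia.mulInt 2).add Ib).lo) || decide (0 ≤ Ib.lo) || decide ((Ib.add (Ig.mulInt 2)).hi ≤ 0) ||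
      (decide (0 ≤ Ig.lo) && decide (0 ≤ (((Ia.mul Ig).mulInt 4).sub Ib.sqr).lo)))

/-- Soundness of `quadTest`: `α + βu + γu² ≥ 0` on `[0, 1]`. [folklore] -/
theorem quad_nonneg_of_quadTest {α β γ : ℝ} {Ia Ib Ig : FI} (h : quadTest Ia Ib Ig = true) (ha : FI.mem α Ia) (hb : FI.mem β Ib)
    (hg : FI.mem γ Ig) {u : ℝ} (hu : u ∈ Icc (0 : ℝ) 1) : 0 ≤ α + β * u + γ * u ^ 2 := by
  simp only [quadTest, Bool.and_eq_true, Bool.or_eq_true, decide_eq_true_eq] at h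
  obtain ⟨⟨h0, h1⟩, hside⟩ := h
  have H0 : 0 ≤ α := nonneg_of_lo_nonneg ha h0
  have H1 : 0 ≤ α + β + γ := nonneg_of_lo_nonneg (FI.mem_add (FI.mem_add ha hb) hg) h1
  refine quad_nonneg_on_unitInterval hu H0 H1 ?_
  rcases hside with ((h2 | h2) | h2) | ⟨h2, h3⟩
  · left
    have := nonneg_of_lo_nonneg (FI.mem_add (FI.mem_mulInt ha 2) hb) h2
    push_cast at this; linarith
  · exact Or.inr (Or.inl (nonneg_of_lo_nonneg hb h2))
  · right; right; left
    have := nonpos_of_hi_nonpos (FI.mem_add hb (FI.mem_mulInt hg 2)) h2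
    push_cast at this; linarith
  · right; right; right
    refine ⟨nonneg_of_lo_nonneg hg h2, ?_⟩
    have := nonneg_of_lo_nonneg (FI.mem_sub (FI.mem_mulInt (FI.mem_mul ha hg) 4) (FI.mem_sqr hb)) h3
    push_cast at this; linarith

/-! ## §3 The nesting leaf -/

/-- The thin interval `[k, k]`. [folklore] -/
def thin (k : ℤ) : FI := ⟨k, k⟩

/-- `k/SC ∈ thin k`. [folklore] -/
theorem mem_thin (k : ℤ) : FI.mem ((k : ℝ) / SC) (thin k) := FI.mem_ofScaled k

/-- **`nestLeaf`** — kernel-decidable sufficient condition for: the Fermi sea of the row `(Δ, a, b, c)` at energy `e` lies inside the Fermi sea of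
`(Δ + s·dΔ, a + s·da, b + s·db, c + s·dc)` at `e + s·σ`, uniformly over the input boxes. [folklore] -/
def nestLeaf (ID IA IB IC IE IDD IDA IDB IDC ISG IS : FI) : Bool :=
  let E0 := fiE ID IE
  let R := fiR IA IC IE
  let P := fiP IA IB IC IE
  let A0 := IE.mul E0.sqr
  let B0 := (E0.mul R).mulInt 4
  let C0 := ((IB.add IC).mul P).mulInt 16
  let dA := fidA ID IE IDD ISG IS
  let dB := fidB ID IA IC IE IDD IDA IDC ISG IS
  let dC := fidC IA IB IC IE IDA IDB IDC ISG IS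
  let B1 := B0.add (IS.mul dB)
  let C1 := C0.add (IS.mul dC)
  decide (0 ≤ IS.lo) && decide (0 < A0.lo) && decide (0 < B0.lo) && decide (0 < C0.lo) && decide (0 < B1.lo) && decide (0 ≤ C1.lo) &&
  match FI.divPos dA A0, FI.divPos dB B0, FI.divPos dC C0, FI.divPos C0 B0, FI.divPos C0 A0, FI.divPos A0 B0 with
  | some rA, some rB, some rC, some cb, some ca, some xr =>
      decide (0 < min xr.hi (SC : ℤ)) &&
        quadTest (rA.sub rB) ((cb.mul (rA.sub rC)).mul (thin (min xr.hi (SC : ℤ))))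
          (((ca.mul (rC.sub rB)).mul (thin (min xr.hi (SC : ℤ)))).mul (thin (min xr.hi (SC : ℤ))))
  | _, _, _, _, _, _ => false

/-- **SOUNDNESS OF `nestLeaf`**: for all reals in the boxes and every `(x, y) ∈ [0, 1]²`,
`charCubic θ x y e ≥ 0 ⇒ charCubic (θ + s·d) x y (e + s·σ) ≥ 0`. [folklore] -/
theorem charCubic_transfer_of_nestLeaf {ID IA IB IC IE IDD IDA IDB IDC ISG IS : FI} (h : nestLeaf ID IA IB IC IE IDD IDA IDB IDC ISG IS = true)
    {Δ a b c e dΔ da db dc σ s : ℝ} (hD : FI.mem Δ ID) (hA : FI.mem a IA) (hB : FI.mem b IB) (hC : FI.mem c IC) (hE : FI.mem e IE)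
    (hDD : FI.mem dΔ IDD) (hDA : FI.mem da IDA) (hDB : FI.mem db IDB) (hDC : FI.mem dc IDC) (hSG : FI.mem σ ISG) (hS : FI.mem s IS)
    {x y : ℝ} (hx : x ∈ Icc (0 : ℝ) 1) (hy : y ∈ Icc (0 : ℝ) 1) (hf : 0 ≤ charCubic Δ a b c x y e) :
    0 ≤ charCubic (Δ + s * dΔ) (a + s * da) (b + s * db) (c + s * dc) x y (e + s * σ) := by
  -- memberships of the real quantities
  have mE0 := mem_fiE hD hE
  have mR := mem_fiR hA hC hE
  have mP := mem_fiP hA hB hC hE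
  have mA0 : FI.mem (cA Δ e) (IE.mul (fiE ID IE).sqr) := mem_of_eq (FI.mem_mul hE (FI.mem_sqr mE0)) (by rw [cA_eq_sn])
  have mB0 : FI.mem (4 * fsD Δ a c e) (((fiE ID IE).mul (fiR IA IC IE)).mulInt 4) :=
    mem_of_eq (FI.mem_mulInt (FI.mem_mul mE0 mR) 4) (by rw [fsD_eq_sn]; push_cast; ring)
  have mC0 : FI.mem (16 * fsN a b c e) (((IB.add IC).mul (fiP IA IB IC IE)).mulInt 16) :=
    mem_of_eq (FI.mem_mulInt (FI.mem_mul (FI.mem_add hB hC) mP) 16) (by rw [fsN_eq_sn]; push_cast; ring)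
  have mdA := mem_fidA hD hE hDD hSG hS
  have mdB := mem_fidB hD hA hC hE hDD hDA hDC hSG hS
  have mdC := mem_fidC hA hB hC hE hDA hDB hDC hSG hS
  have mB1 : FI.mem (4 * fsD (Δ + s * dΔ) (a + s * da) (c + s * dc) (e + s * σ))
      ((((fiE ID IE).mul (fiR IA IC IE)).mulInt 4).add (IS.mul (fidB ID IA IC IE IDD IDA IDC ISG IS))) :=
    mem_of_eq (FI.mem_add mB0 (FI.mem_mul hS mdB)) (by rw [four_fsD_move])
  have mC1 : FI.mem (16 * fsN (a + s * da) (b + s * db) (c + s * dc) (e + s * σ))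
      ((((IB.add IC).mul (fiP IA IB IC IE)).mulInt 16).add (IS.mul (fidC IA IB IC IE IDA IDB IDC ISG IS))) :=
    mem_of_eq (FI.mem_add mC0 (FI.mem_mul hS mdC)) (by rw [sixteen_fsN_move])
  -- unpack the test
  unfold nestLeaf at h
  simp only [Bool.and_eq_true, decide_eq_true_eq] at h
  obtain ⟨⟨⟨⟨⟨⟨hs0, hA0⟩, hB0⟩, hC0⟩, hB1⟩, hC1⟩, hrest⟩ := h
  have Hs : 0 ≤ s := nonneg_of_lo_nonneg hS hs0
  have HA0 : 0 < cA Δ e := FI.pos_of_lo_pos mA0 hA0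
  have HB0 : 0 < 4 * fsD Δ a c e := FI.pos_of_lo_pos mB0 hB0
  have HC0 : 0 < 16 * fsN a b c e := FI.pos_of_lo_pos mC0 hC0
  have HB1 : 0 < 4 * fsD (Δ + s * dΔ) (a + s * da) (c + s * dc) (e + s * σ) := FI.pos_of_lo_pos mB1 hB1
  have HC1 : 0 ≤ 16 * fsN (a + s * da) (b + s * db) (c + s * dc) (e + s * σ) := nonneg_of_lo_nonneg mC1 hC1
  -- the six quotients
  split at hrest
  · rename_i rA rB rC cb ca xr hrA hrB hrC hcb hca hxr
    simp only [Bool.and_eq_true, decide_eq_true_eq] at hrest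
    obtain ⟨hxh, hq⟩ := hrest
    set A0r := cA Δ e with hA0r
    set B0r := 4 * fsD Δ a c e with hB0r
    set C0r := 16 * fsN a b c e with hC0r
    set dAr := dsnA Δ e dΔ σ s
    set dBr := dsnB Δ a c e dΔ da dc σ s
    set dCr := dsnC a b c e da db dc σ s
    have mρA : FI.mem (dAr / A0r) rA := FI.mem_divPos hrA mdA mA0
    have mρB : FI.mem (dBr / B0r) rB := FI.mem_divPos hrB mdB mB0
    have mρC : FI.mem (dCr / C0r) rC := FI.mem_divPos hrC mdC mC0
    have mcb : FI.mem (C0r / B0r) cb := FI.mem_divPos hcb mC0 mB0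
    have mca : FI.mem (C0r / A0r) ca := FI.mem_divPos hca mC0 mA0
    have mxr : FI.mem (A0r / B0r) xr := FI.mem_divPos hxr mA0 mB0
    -- the cut x ≤ xhr := min(xr.hi, SC)/SC
    set xh : ℤ := min xr.hi (SC : ℤ) with hxhdef
    have mX : FI.mem ((xh : ℝ) / SC) (thin xh) := mem_thin xh
    have hxhr_pos : 0 < (xh : ℝ) / SC := div_pos (by exact_mod_cast hxh) SC_pos
    -- occupied points satisfy x ≤ A/B ≤ xhr and x ≤ 1
    have hxAB : x ≤ A0r / B0r := by
      rw [le_div_iff₀ HB0]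
      rw [charCubic_bilinear] at hf
      have hy0 := hy.1
      have hx0 := hx.1
      have h16 : 0 ≤ 16 * fsN a b c e := HC0.le
      have : 0 ≤ (4 * fsD Δ a c e) * y + (16 * fsN a b c e) * (x * y) := by
        have := HB0.le; positivity
      nlinarith
    have hx_le : x ≤ (xh : ℝ) / SC := by
      rcases le_total xr.hi (SC : ℤ) with hle | hle
      · have : xh = xr.hi := by rw [hxhdef]; exact min_eq_left hle
        rw [this]
        exact hxAB.trans (FI.le_hi_div mxr)
      · have : xh = SC := by rw [hxhdef]; exact min_eq_right hle
        rw [this]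
        have : ((SC : ℤ) : ℝ) / SC = 1 := by push_cast; exact div_self SC_ne
        rw [this]; exact hx.2
    -- u := x / xhr ∈ [0, 1]; q̂(x) = α + (β xhr) u + (γ xhr²) u²
    set xhr := (xh : ℝ) / SC with hxhr
    set u := x / xhr with hudef
    have hu : u ∈ Icc (0 : ℝ) 1 := ⟨div_nonneg hx.1 hxhr_pos.le, by rw [hudef, div_le_one hxhr_pos]; exact hx_le⟩
    have hxu : x = xhr * u := by rw [hudef]; field_simp
    have hquad := quad_nonneg_of_quadTest hq (FI.mem_sub mρA mρB) (FI.mem_mul (FI.mem_mul mcb (FI.mem_sub mρA mρC)) mX)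
      (FI.mem_mul (FI.mem_mul (FI.mem_mul mca (FI.mem_sub mρC mρB)) mX) mX) hu
    have hqhat : 0 ≤ (dAr / A0r - dBr / B0r) + (C0r / B0r * (dAr / A0r - dCr / C0r)) * x + (C0r / A0r * (dCr / C0r - dBr / B0r)) * x ^ 2 := by
      rw [hxu]
      have e : (dAr / A0r - dBr / B0r) + (C0r / B0r * (dAr / A0r - dCr / C0r)) * (xhr * u) + (C0r / A0r * (dCr / C0r - dBr / B0r)) * (xhr * u) ^ 2 =
          (dAr / A0r - dBr / B0r) + (C0r / B0r * (dAr / A0r - dCr / C0r) * xhr) * u + (C0r / A0r * (dCr / C0r - dBr / B0r) * xhr * xhr) * u ^ 2 := by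
        ring
      rw [e]; exact hquad
    -- ratio form ⇒ q(x) ≥ 0
    have hqq := nestQuad_nonneg_of_ratio (x := x) HA0 HB0 Hs (div_mul_cancel₀ dAr HA0.ne') (div_mul_cancel₀ dBr HB0.ne')
      (div_mul_cancel₀ dCr HC0.ne') hqhat
    -- conclude with the contour transfer
    have hD0 : 0 < fsD Δ a c e := by linarith
    have hN0 : 0 ≤ fsN a b c e := by linarith
    have hD1 : 0 < fsD (Δ + s * dΔ) (a + s * da) (c + s * dc) (e + s * σ) := by linarith
    have hN1 : 0 ≤ fsN (a + s * da) (b + s * db) (c + s * dc) (e + s * σ) := by linarith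
    refine charCubic_nonneg_transfer hx hD0 hN0 hD1 hN1 ?_ hf
    rw [cA_move, four_fsD_move, sixteen_fsN_move]
    exact hqq
  · exact absurd hrest Bool.false_ne_true

end Summit.Ventures.CertifiedManyBodySolver.Downfold.Emery
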